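import Summits.CriticalPhenomena.PercolationContinuityZ3.Theorems.PercNearOneGluingNoHeavyLowerTailKnQuestion8CoefficientwiseCoreClassOneSidedRootSteps
import HarnessLib

/-!
# The one-sided root inequality for bundles, III: the slice step (run and stopper of opposite colours)

Support file (`--supports stmt-CriticalPhenomena-4575`, closed), prover `prim-cplus-coupling` (gen 33).  No definitions, no named facts, no sorries;
standard axioms.  Memo `prim-cplus-coupling/A5-COUPLING-gen33.md` §1.  Setting and the generalized sum `S(E, R, Run)` as in `…CoreClassOneSidedRootSteps`.

Let the tied run `Run ≠ ∅` at `c` end at the internal vertex `tip ∈ W` and let `f = {tip, w}` be the next edge of the arm (the STOPPER).  The colourings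
with `Run` monochromatic split into those with `f` of the run's colour (the longer run `Run + f`, handled by the induction) and the SLICE: `f` of the
opposite colour.  On the slice the run colour `ε` is a free bit: with `ω° = ω ∖ (Run + f)`, `X° = C_c ω°`, `Y° = C_c(E° ∖ ω°)` (`E° = E ∖ (Run + f)`),
  `ε = red`:  `C_c ω = X° ∪ W`,                 `C_c(E∖ω) = Y° ∪ {tip | w ∈ Y°}`;
  `ε = blue`: `C_c ω = X° ∪ {tip | w ∈ X°}`,    `C_c(E∖ω) = Y° ∪ W`
(LEMMAS A, B of `…OneSidedRootRuns`), and one-bit Chebyshev gives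
* `Coefficientwise.osr_step_slice` — `SLICE ≥ 2·S(E°, R, ∅)` for the averaged levels `H̄ = (H(·∪W) + H(·∪{tip | w ∈ ·}))/2`,
  `H̄ᵇ = (Hᵇ(·∪{tip | w ∈ ·}) + Hᵇ(·∪W))/2` (monotone, `H̄ᵇ ≤ H̄` by cross-matching);
* `Coefficientwise.osr_split_run` — `S(E, R, Run) = S(E, R, Run + f) + SLICE` (pointwise);
* `Coefficientwise.sum_ite_congr_prop` — exchanging equivalent conditions under a sum.
[cite: KozmaNitzan2024, Questions 8–9 (§5.5 p. 36) (context: the Question-8 pocket covariance programme)]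
-/

namespace Summit.CriticalPhenomena.PercolationContinuityZ3.Theorems

open Finset Literature.Probability.Percolation

namespace Coefficientwise

variable {ι V : Type*}

/-- Exchanging equivalent conditions under a sum of `if … then g else 0`. [cite: KozmaNitzan2024, §5.5 (context only; bookkeeping)] -/
theorem sum_ite_congr_prop (s : Finset (Finset ι)) (P P' : Finset ι → Prop) [DecidablePred P] [DecidablePred P']
    (g : Finset ι → ℝ) (h : ∀ ω ∈ s, (P ω ↔ P' ω)) :
    ∑ ω ∈ s, (if P ω then g ω else 0) = ∑ ω ∈ s, (if P' ω then g ω else 0) := by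
  refine Finset.sum_congr rfl fun ω hω => ?_
  by_cases hP : P ω
  · rw [if_pos hP, if_pos ((h ω hω).mp hP)]
  · rw [if_neg hP, if_neg (fun h' => hP ((h ω hω).mpr h'))]

/-- Splitting an indicator along an exclusive disjunction: if `M ↔ M′ ∨ N` and not both `M′, N`, then
`[A ∧ M ∧ B]·x = [A ∧ M′ ∧ B]·x + [A ∧ N ∧ B]·x`. [cite: KozmaNitzan2024, §5.5 (context only; bookkeeping)] -/
theorem ite_and_or_split {A M M' N B : Prop} [Decidable (A ∧ M ∧ B)] [Decidable (A ∧ M' ∧ B)] [Decidable (A ∧ N ∧ B)]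
    (x : ℝ) (h1 : M ↔ M' ∨ N) (h2 : ¬ (M' ∧ N)) :
    (if A ∧ M ∧ B then x else 0) = (if A ∧ M' ∧ B then x else 0) + (if A ∧ N ∧ B then x else 0) := by
  by_cases hM' : M'
  · have hN : ¬ N := fun hN => h2 ⟨hM', hN⟩
    have hM : M := h1.mpr (Or.inl hM')
    by_cases hAB : A ∧ B
    · rw [if_pos ⟨hAB.1, hM, hAB.2⟩, if_pos ⟨hAB.1, hM', hAB.2⟩, if_neg (fun h => hN h.2.1), add_zero]
    · rw [if_neg (fun h => hAB ⟨h.1, h.2.2⟩), if_neg (fun h => hAB ⟨h.1, h.2.2⟩), if_neg (fun h => hAB ⟨h.1, h.2.2⟩), add_zero]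
  · by_cases hN : N
    · have hM : M := h1.mpr (Or.inr hN)
      by_cases hAB : A ∧ B
      · rw [if_pos ⟨hAB.1, hM, hAB.2⟩, if_neg (fun h => hM' h.2.1), if_pos ⟨hAB.1, hN, hAB.2⟩, zero_add]
      · rw [if_neg (fun h => hAB ⟨h.1, h.2.2⟩), if_neg (fun h => hAB ⟨h.1, h.2.2⟩), if_neg (fun h => hAB ⟨h.1, h.2.2⟩), add_zero]
    · have hM : ¬ M := fun hM => (h1.mp hM).elim hM' hN
      rw [if_neg (fun h => hM h.2.1), if_neg (fun h => hM' h.2.1), if_neg (fun h => hN h.2.1), add_zero]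

open Classical in
/-- **SPLIT along the next edge.**  For `Run ≠ ∅` and `f ∉ Run`, with `D = insert f Run`:
`[Run ⊆ ω ∨ Run ∩ ω = ∅] = [D ⊆ ω ∨ D ∩ ω = ∅] + [ω ∩ D = Run ∨ ω ∩ D = {f}]` inside the indicator of `S(E, R, Run)`, summed over `ω`.
[cite: KozmaNitzan2024, §5.5 (context only; bookkeeping)] -/
theorem osr_split_run (ends : ι → Sym2 V) (E R Run : Finset ι) (c a : V) (f : ι) (hne : Run.Nonempty) (hf : f ∉ Run)
    (H Hb K Kb : Set V → ℝ) :
    ∑ ω ∈ E.powerset, (if R ⊆ ω ∧ (Run ⊆ ω ∨ Disjoint Run ω) ∧ a ∈ openCluster (ends '' (↑ω : Set ι)) c ∧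
        a ∉ openCluster (ends '' (↑(E \ ω) : Set ι)) c then
        (H (openCluster (ends '' (↑ω : Set ι)) c) - Hb (openCluster (ends '' (↑(E \ ω) : Set ι)) c)) *
          (K (openCluster (ends '' (↑ω : Set ι)) c) - Kb (openCluster (ends '' (↑(E \ ω) : Set ι)) c)) else 0)
    = ∑ ω ∈ E.powerset, (if R ⊆ ω ∧ (insert f Run ⊆ ω ∨ Disjoint (insert f Run) ω) ∧ a ∈ openCluster (ends '' (↑ω : Set ι)) c ∧
        a ∉ openCluster (ends '' (↑(E \ ω) : Set ι)) c then
        (H (openCluster (ends '' (↑ω : Set ι)) c) - Hb (openCluster (ends '' (↑(E \ ω) : Set ι)) c)) *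
          (K (openCluster (ends '' (↑ω : Set ι)) c) - Kb (openCluster (ends '' (↑(E \ ω) : Set ι)) c)) else 0)
      + ∑ ω ∈ E.powerset, (if R ⊆ ω ∧ (ω ∩ insert f Run = Run ∨ ω ∩ insert f Run = {f}) ∧ a ∈ openCluster (ends '' (↑ω : Set ι)) c ∧
        a ∉ openCluster (ends '' (↑(E \ ω) : Set ι)) c then
        (H (openCluster (ends '' (↑ω : Set ι)) c) - Hb (openCluster (ends '' (↑(E \ ω) : Set ι)) c)) *
          (K (openCluster (ends '' (↑ω : Set ι)) c) - Kb (openCluster (ends '' (↑(E \ ω) : Set ι)) c)) else 0) := by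
  rw [← Finset.sum_add_distrib]
  refine Finset.sum_congr rfl fun ω _ => ite_and_or_split _ ?_ ?_
  · -- Run-mono ↔ D-mono ∨ disagree
    rw [Finset.insert_subset_iff, Finset.disjoint_insert_left]
    constructor
    · rintro (hR | hR)
      · by_cases hfω : f ∈ ω
        · exact Or.inl (Or.inl ⟨hfω, hR⟩)
        · refine Or.inr (Or.inl ?_)
          ext i
          simp only [Finset.mem_inter, Finset.mem_insert]
          constructor
          · rintro ⟨hiω, rfl | hi⟩
            · exact absurd hiω hfω
            · exact hi
          · intro hi; exact ⟨hR hi, Or.inr hi⟩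
      · by_cases hfω : f ∈ ω
        · refine Or.inr (Or.inr ?_)
          ext i
          simp only [Finset.mem_inter, Finset.mem_insert, Finset.mem_singleton]
          constructor
          · rintro ⟨hiω, rfl | hi⟩
            · rfl
            · exact absurd hiω (Finset.disjoint_left.mp hR hi)
          · rintro rfl; exact ⟨hfω, Or.inl rfl⟩
        · exact Or.inl (Or.inr ⟨hfω, hR⟩)
    · rintro ((⟨_, hR⟩ | ⟨_, hR⟩) | (hR | hR))
      · exact Or.inl hR
      · exact Or.inr hR
      · left; intro i hi
        have : i ∈ ω ∩ insert f Run := by rw [hR]; exact hi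
        exact (Finset.mem_inter.mp this).1
      · right
        rw [Finset.disjoint_left]
        intro i hi hiω
        have : i ∈ ω ∩ insert f Run := Finset.mem_inter.mpr ⟨hiω, Finset.mem_insert_of_mem hi⟩
        rw [hR, Finset.mem_singleton] at this
        exact hf (this ▸ hi)
  · -- not both
    rintro ⟨hM | hM, hN | hN⟩
    · have : f ∈ ω ∩ insert f Run := Finset.mem_inter.mpr ⟨hM (Finset.mem_insert_self f Run), Finset.mem_insert_self f Run⟩
      rw [hN] at this; exact hf this
    · obtain ⟨i, hi⟩ := hne
      have : i ∈ ω ∩ insert f Run := Finset.mem_inter.mpr ⟨hM (Finset.mem_insert_of_mem hi), Finset.mem_insert_of_mem hi⟩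
      rw [hN, Finset.mem_singleton] at this; exact hf (this ▸ hi)
    · obtain ⟨i, hi⟩ := hne
      have : i ∈ ω ∩ insert f Run := by rw [hN]; exact hi
      exact Finset.disjoint_left.mp hM (Finset.mem_insert_of_mem hi) (Finset.mem_inter.mp this).1
    · have : f ∈ ω ∩ insert f Run := by rw [hN]; exact Finset.mem_singleton_self f
      exact Finset.disjoint_left.mp hM (Finset.mem_insert_self f Run) (Finset.mem_inter.mp this).1

open Classical in
/-- **SLICE STEP.**  `Run ⊆ E ∖ R` with ends in `W ∪ {c}`, `W` joined to `c` by `Run`, `tip ∈ W`, `c, a ∉ W`; the stopper `f ∈ E ∖ R`, `f ∉ Run`,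
`ends f = {tip, w}`, `tip ≠ w`; no edge of `E` other than those of `Run` and `f` meets `W`.  Then the slice (run and stopper of opposite colours) is
`≥ 2·S(E ∖ (Run + f), R, ∅)` for the averaged levels `H̄ = (H(·∪W) + H(·∪{tip | w ∈ ·}))/2`, `H̄ᵇ = (Hᵇ(·∪{tip | w ∈ ·}) + Hᵇ(·∪W))/2`.
[cite: KozmaNitzan2024, Questions 8–9 (§5.5 p. 36) (context)] -/
theorem osr_step_slice (ends : ι → Sym2 V) (E R Run : Finset ι) (W : Set V) (c a tip w : V) (f : ι)
    (hRunE : Run ⊆ E) (hRunR : ∀ i ∈ Run, i ∉ R)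
    (hfE : f ∈ E) (hfR : f ∉ R) (hfRun : f ∉ Run) (hf : ends f = s(tip, w)) (htw : tip ≠ w)
    (hRun : ∀ i ∈ Run, ∀ x, x ∈ ends i → x ∈ W ∨ x = c)
    (hW : ∀ x ∈ W, x ∈ openCluster (ends '' (↑Run : Set ι)) c)
    (hpriv : ∀ i ∈ E, i ∉ Run → i ≠ f → ∀ x, x ∈ ends i → x ∉ W)
    (htip : tip ∈ W) (haW : a ∉ W) (hcW : c ∉ W)
    (H Hb K Kb : Set V → ℝ) (hH : Monotone H) (hHb : Monotone Hb) (hK : Monotone K) (hKb : Monotone Kb) :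
    2 * ∑ ω ∈ (E \ insert f Run).powerset, (if R ⊆ ω ∧ (∅ ⊆ ω ∨ Disjoint ∅ ω) ∧ a ∈ openCluster (ends '' (↑ω : Set ι)) c ∧
        a ∉ openCluster (ends '' (↑((E \ insert f Run) \ ω) : Set ι)) c then
        ((H (openCluster (ends '' (↑ω : Set ι)) c ∪ W) +
              H (openCluster (ends '' (↑ω : Set ι)) c ∪ {y | y = tip ∧ w ∈ openCluster (ends '' (↑ω : Set ι)) c})) / 2 -
            (Hb (openCluster (ends '' (↑((E \ insert f Run) \ ω) : Set ι)) c ∪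
                  {y | y = tip ∧ w ∈ openCluster (ends '' (↑((E \ insert f Run) \ ω) : Set ι)) c}) +
              Hb (openCluster (ends '' (↑((E \ insert f Run) \ ω) : Set ι)) c ∪ W)) / 2) *
          ((K (openCluster (ends '' (↑ω : Set ι)) c ∪ W) +
              K (openCluster (ends '' (↑ω : Set ι)) c ∪ {y | y = tip ∧ w ∈ openCluster (ends '' (↑ω : Set ι)) c})) / 2 -
            (Kb (openCluster (ends '' (↑((E \ insert f Run) \ ω) : Set ι)) c ∪
                  {y | y = tip ∧ w ∈ openCluster (ends '' (↑((E \ insert f Run) \ ω) : Set ι)) c}) +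
              Kb (openCluster (ends '' (↑((E \ insert f Run) \ ω) : Set ι)) c ∪ W)) / 2) else 0)
    ≤ ∑ ω ∈ E.powerset, (if R ⊆ ω ∧ (ω ∩ insert f Run = Run ∨ ω ∩ insert f Run = {f}) ∧ a ∈ openCluster (ends '' (↑ω : Set ι)) c ∧
        a ∉ openCluster (ends '' (↑(E \ ω) : Set ι)) c then
        (H (openCluster (ends '' (↑ω : Set ι)) c) - Hb (openCluster (ends '' (↑(E \ ω) : Set ι)) c)) *
          (K (openCluster (ends '' (↑ω : Set ι)) c) - Kb (openCluster (ends '' (↑(E \ ω) : Set ι)) c)) else 0) := by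
  set X : Finset ι → Set V := fun ω => openCluster (ends '' (↑ω : Set ι)) c with hX
  set D : Finset ι := insert f Run with hD
  set E' : Finset ι := E \ D with hE'
  set g : Finset ι → ℝ := fun ω => (H (X ω) - Hb (X (E \ ω))) * (K (X ω) - Kb (X (E \ ω))) with hg
  set Q : Finset ι → Prop := fun ω => R ⊆ ω ∧ a ∈ X ω ∧ a ∉ X (E \ ω) with hQ
  change 2 * ∑ ω ∈ E'.powerset, (if R ⊆ ω ∧ (∅ ⊆ ω ∨ Disjoint ∅ ω) ∧ a ∈ X ω ∧ a ∉ X (E' \ ω) then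
      ((H (X ω ∪ W) + H (X ω ∪ {y | y = tip ∧ w ∈ X ω})) / 2 - (Hb (X (E' \ ω) ∪ {y | y = tip ∧ w ∈ X (E' \ ω)}) + Hb (X (E' \ ω) ∪ W)) / 2) *
        ((K (X ω ∪ W) + K (X ω ∪ {y | y = tip ∧ w ∈ X ω})) / 2 - (Kb (X (E' \ ω) ∪ {y | y = tip ∧ w ∈ X (E' \ ω)}) + Kb (X (E' \ ω) ∪ W)) / 2)
      else 0)
    ≤ ∑ ω ∈ E.powerset, (if R ⊆ ω ∧ (ω ∩ D = Run ∨ ω ∩ D = {f}) ∧ a ∈ X ω ∧ a ∉ X (E \ ω) then g ω else 0)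
  have hDE : D ⊆ E := Finset.insert_subset hfE hRunE
  have hRunD : Run ⊆ D := Finset.subset_insert f Run
  have hfD : {f} ⊆ D := Finset.singleton_subset_iff.mpr (Finset.mem_insert_self f Run)
  have hRunf : Run ≠ {f} := fun h => hfRun (by rw [h]; exact Finset.mem_singleton_self f)
  have hDRun : D \ Run = {f} := by
    ext i
    simp only [hD, Finset.mem_sdiff, Finset.mem_insert, Finset.mem_singleton]
    constructor
    · rintro ⟨rfl | hi, hni⟩
      · rfl
      · exact absurd hi hni
    · rintro rfl; exact ⟨Or.inl rfl, hfRun⟩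
  have hDf : D \ {f} = Run := by
    ext i
    simp only [hD, Finset.mem_sdiff, Finset.mem_insert, Finset.mem_singleton]
    constructor
    · rintro ⟨rfl | hi, hni⟩
      · exact absurd rfl hni
      · exact hi
    · intro hi; exact ⟨Or.inr hi, fun h => hfRun (h ▸ hi)⟩
  -- split the slice along `ω ∩ D ∈ {Run, {f}}` and reindex over `E'`
  have hsplit : ∀ ω ∈ E.powerset, (if R ⊆ ω ∧ (ω ∩ D = Run ∨ ω ∩ D = {f}) ∧ a ∈ X ω ∧ a ∉ X (E \ ω) then g ω else 0)
      = (if ω ∩ D = Run then (if Q ω then g ω else 0) else 0) + (if ω ∩ D = {f} then (if Q ω then g ω else 0) else 0) := by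
    intro ω _
    rw [ite_and_or_split (A := R ⊆ ω) (M := ω ∩ D = Run ∨ ω ∩ D = {f}) (M' := ω ∩ D = Run) (N := ω ∩ D = {f})
      (B := a ∈ X ω ∧ a ∉ X (E \ ω)) (g ω) Iff.rfl (fun h => hRunf (h.1.symm.trans h.2))]
    congr 1
    · by_cases h1 : ω ∩ D = Run
      · by_cases hQω : Q ω
        · rw [if_pos ⟨hQω.1, h1, hQω.2⟩, if_pos h1, if_pos hQω]
        · rw [if_neg (fun h => hQω ⟨h.1, h.2.2⟩), if_pos h1, if_neg hQω]
      · rw [if_neg (fun h => h1 h.2.1), if_neg h1]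
    · by_cases h1 : ω ∩ D = {f}
      · by_cases hQω : Q ω
        · rw [if_pos ⟨hQω.1, h1, hQω.2⟩, if_pos h1, if_pos hQω]
        · rw [if_neg (fun h => hQω ⟨h.1, h.2.2⟩), if_pos h1, if_neg hQω]
      · rw [if_neg (fun h => h1 h.2.1), if_neg h1]
  have hA : (∑ ω ∈ E.powerset, (if ω ∩ D = Run then (if Q ω then g ω else 0) else 0))
      = ∑ ω ∈ E'.powerset, (if Q (ω ∪ Run) then g (ω ∪ Run) else 0) := by
    rw [show (∑ ω ∈ E.powerset, (if ω ∩ D = Run then (if Q ω then g ω else 0) else 0))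
        = ∑ ω ∈ E.powerset.filter (fun ω => ω ∩ D = Run), (if Q ω then g ω else 0) from (Finset.sum_filter _ _).symm]
    exact sum_powerset_inter_eq E D Run hDE hRunD _
  have hB : (∑ ω ∈ E.powerset, (if ω ∩ D = {f} then (if Q ω then g ω else 0) else 0))
      = ∑ ω ∈ E'.powerset, (if Q (ω ∪ {f}) then g (ω ∪ {f}) else 0) := by
    rw [show (∑ ω ∈ E.powerset, (if ω ∩ D = {f} then (if Q ω then g ω else 0) else 0))
        = ∑ ω ∈ E.powerset.filter (fun ω => ω ∩ D = {f}), (if Q ω then g ω else 0) from (Finset.sum_filter _ _).symm]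
    exact sum_powerset_inter_eq E D {f} hDE hfD _
  have hS : (∑ ω ∈ E.powerset, (if R ⊆ ω ∧ (ω ∩ D = Run ∨ ω ∩ D = {f}) ∧ a ∈ X ω ∧ a ∉ X (E \ ω) then g ω else 0))
      = (∑ ω ∈ E'.powerset, (if Q (ω ∪ Run) then g (ω ∪ Run) else 0)) + ∑ ω ∈ E'.powerset, (if Q (ω ∪ {f}) then g (ω ∪ {f}) else 0) := by
    rw [Finset.sum_congr rfl hsplit, Finset.sum_add_distrib, hA, hB]
  rw [hS]
  -- cluster bookkeeping on `E'`
  have hprivω : ∀ ω, ω ⊆ E' → ∀ i ∈ ω, ∀ x, x ∈ ends i → x ∉ W := by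
    intro ω hω i hi x hx
    have hi' := Finset.mem_sdiff.mp (hω hi)
    have hiRun : i ∉ Run := fun h => hi'.2 (hRunD h)
    have hif : i ≠ f := fun h => hi'.2 (h ▸ Finset.mem_insert_self f Run)
    exact hpriv i hi'.1 hiRun hif x hx
  have hprivtip : ∀ ω, ω ⊆ E' → ∀ i ∈ ω, tip ∉ ends i := fun ω hω i hi htipi => hprivω ω hω i hi tip htipi htip
  have htc : tip ≠ c := fun h => hcW (h ▸ htip)
  have hXA : ∀ ω, ω ⊆ E' → X (ω ∪ Run) = X ω ∪ W := fun ω hω =>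
    openCluster_union_privateBlob ends ω Run W c hRun hW (hprivω ω hω)
  have hXB : ∀ ω, ω ⊆ E' → X (ω ∪ {f}) = X ω ∪ {y | y = tip ∧ w ∈ X ω} := fun ω hω =>
    openCluster_union_stopper ends ω f tip w c hf htc htw (hprivtip ω hω)
  have hYA : ∀ ω, ω ⊆ E' → X (E \ (ω ∪ Run)) = X (E' \ ω) ∪ {y | y = tip ∧ w ∈ X (E' \ ω)} := by
    intro ω hω
    rw [sdiff_union_tied E D Run ω hDE hω hRunD, hDRun]
    exact openCluster_union_stopper ends (E' \ ω) f tip w c hf htc htw (hprivtip (E' \ ω) Finset.sdiff_subset)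
  have hYB : ∀ ω, ω ⊆ E' → X (E \ (ω ∪ {f})) = X (E' \ ω) ∪ W := by
    intro ω hω
    rw [sdiff_union_tied E D {f} ω hDE hω hfD, hDf]
    exact openCluster_union_privateBlob ends (E' \ ω) Run W c hRun hW (hprivω (E' \ ω) Finset.sdiff_subset)
  have hat : a ≠ tip := fun h => haW (h ▸ htip)
  rw [Finset.mul_sum, ← Finset.sum_add_distrib]
  refine Finset.sum_le_sum fun ω hω => ?_
  have hωE' : ω ⊆ E' := Finset.mem_powerset.mp hω
  have hQA : Q (ω ∪ Run) ↔ (R ⊆ ω ∧ a ∈ X ω ∧ a ∉ X (E' \ ω)) := by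
    simp only [hQ]
    rw [hXA ω hωE', hYA ω hωE']
    constructor
    · rintro ⟨hR, ha, hb⟩
      refine ⟨fun i hi => ?_, ha.elim id (fun h => absurd h haW), fun h => hb (Or.inl h)⟩
      rcases Finset.mem_union.mp (hR hi) with h | h
      · exact h
      · exact absurd hi (hRunR i h)
    · rintro ⟨hR, ha, hb⟩
      exact ⟨hR.trans Finset.subset_union_left, Or.inl ha, fun h => h.elim hb (fun h' => hat h'.1)⟩
  have hQB : Q (ω ∪ {f}) ↔ (R ⊆ ω ∧ a ∈ X ω ∧ a ∉ X (E' \ ω)) := by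
    simp only [hQ]
    rw [hXB ω hωE', hYB ω hωE']
    constructor
    · rintro ⟨hR, ha, hb⟩
      refine ⟨fun i hi => ?_, ha.elim id (fun h => absurd h.1 hat), fun h => hb (Or.inl h)⟩
      rcases Finset.mem_union.mp (hR hi) with h | h
      · exact h
      · rw [Finset.mem_singleton] at h; exact absurd hi (h ▸ hfR)
    · rintro ⟨hR, ha, hb⟩
      exact ⟨hR.trans Finset.subset_union_left, Or.inl ha, fun h => h.elim hb haW⟩
  by_cases hQ' : R ⊆ ω ∧ a ∈ X ω ∧ a ∉ X (E' \ ω)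
  · rw [if_pos ⟨hQ'.1, Or.inl (Finset.empty_subset _), hQ'.2⟩, if_pos (hQA.mpr hQ'), if_pos (hQB.mpr hQ')]
    simp only [hg]
    rw [hXA ω hωE', hYA ω hωE', hXB ω hωE', hYB ω hωE']
    have s1 : X ω ∪ {y | y = tip ∧ w ∈ X ω} ⊆ X ω ∪ W := by
      rintro y (hy | ⟨hy, _⟩)
      · exact Or.inl hy
      · exact Or.inr (hy ▸ htip)
    have s2 : X (E' \ ω) ∪ {y | y = tip ∧ w ∈ X (E' \ ω)} ⊆ X (E' \ ω) ∪ W := by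
      rintro y (hy | ⟨hy, _⟩)
      · exact Or.inl hy
      · exact Or.inr (hy ▸ htip)
    have hf' : H (X ω ∪ {y | y = tip ∧ w ∈ X ω}) - Hb (X (E' \ ω) ∪ W) ≤ H (X ω ∪ W) - Hb (X (E' \ ω) ∪ {y | y = tip ∧ w ∈ X (E' \ ω)}) := by
      linarith [hH s1, hHb s2]
    have hk' : K (X ω ∪ {y | y = tip ∧ w ∈ X ω}) - Kb (X (E' \ ω) ∪ W) ≤ K (X ω ∪ W) - Kb (X (E' \ ω) ∪ {y | y = tip ∧ w ∈ X (E' \ ω)}) := by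
      linarith [hK s1, hKb s2]
    have key := oneBit_chebyshev _ _ _ _ hf' hk'
    have e1 : (H (X ω ∪ W) - Hb (X (E' \ ω) ∪ {y | y = tip ∧ w ∈ X (E' \ ω)}) + (H (X ω ∪ {y | y = tip ∧ w ∈ X ω}) - Hb (X (E' \ ω) ∪ W))) / 2 =
        (H (X ω ∪ W) + H (X ω ∪ {y | y = tip ∧ w ∈ X ω})) / 2 - (Hb (X (E' \ ω) ∪ {y | y = tip ∧ w ∈ X (E' \ ω)}) + Hb (X (E' \ ω) ∪ W)) / 2 := by
      ring
    have e2 : (K (X ω ∪ W) - Kb (X (E' \ ω) ∪ {y | y = tip ∧ w ∈ X (E' \ ω)}) + (K (X ω ∪ {y | y = tip ∧ w ∈ X ω}) - Kb (X (E' \ ω) ∪ W))) / 2 =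
        (K (X ω ∪ W) + K (X ω ∪ {y | y = tip ∧ w ∈ X ω})) / 2 - (Kb (X (E' \ ω) ∪ {y | y = tip ∧ w ∈ X (E' \ ω)}) + Kb (X (E' \ ω) ∪ W)) / 2 := by
      ring
    rw [e1, e2] at key
    linarith
  · rw [if_neg (fun h => hQ' ⟨h.1, h.2.2⟩), if_neg (fun h => hQ' (hQA.mp h)), if_neg (fun h => hQ' (hQB.mp h))]
    linarith

end Coefficientwise

end Summit.CriticalPhenomena.PercolationContinuityZ3.Theorems
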